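import Mathlib
import Summits.ValiantsHypothesis.ValiantsHypothesis.Theorems.RigidityForcesSymmetryRankRigidMinimalReprLaplaceFiveCertified2
import Summits.ValiantsHypothesis.ValiantsHypothesis.Theorems.RigidityForcesSymmetryRankRigidMinimalReprLaplaceFiveThreeSlicesCertsA
import Summits.ValiantsHypothesis.ValiantsHypothesis.Theorems.RigidityForcesSymmetryRankRigidMinimalReprLaplaceFiveThreeSlicesCertsB
import Summits.ValiantsHypothesis.ValiantsHypothesis.Theorems.RigidityForcesSymmetryRankRigidMinimalReprLaplaceFiveThreeSlicesCertsC

/-!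
# `LaplaceOptimalFive`, slice class `a = 3`: three slices + three pairs ≠ P₅ for every certified sorted configuration
# (crux `RankRigidMinimalRepr`, stmt-ValiantsHypothesis-18034; frontier rung `LaplaceOptimalFive`, stmt-24813)

The assembly step between the kernel-checked certificate tables `three_slices_certs_{A,B,C}`
(`…LaplaceFiveThreeSlicesCerts{A,B,C}.lean`) and the dual refutation `certified_no_decomposition2`
(`…LaplaceFiveCertified2.lean`):

* `three_slices_of_clauses` — a certificate `c = ((o, oi), (side, lp, e1, e2), (hb, bp, dk, dt))` passing the eight
  Boolean clauses of the tables supplies every hypothesis of `certified_no_decomposition2` (slot order `⟨o, oi⟩`, basis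
  marking `{bp}` when `hb = 1`, the single designation there — slice `dt` if `dk = 0`, pair term `dt` if `dk = 1`), so
  the purported decomposition `P₅ = Σ_k α_k(v_{i k}) W_k + Σ_t u_t(v_{p t}, v_{q t}) w_t` is impossible;
* `three_slices_sorted_A / _B / _C` — for three slices on the slots `![0,0,0]` / `![0,0,1]` / `![0,1,2]` and three
  pair terms on SORTED cuts (`p t < q t`, codes `5 p t + q t` non-decreasing) outside the exception lists of the tables
  (14 / 6 / 7 sorted configurations = 10 types up to the symmetries), the decomposition identity is impossible — for
  arbitrary slice vectors, cofactors and pair factors (zero terms allowed).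

What is NOT here: the reduction of an arbitrary labelling (slots `i : Fin 3 → Fin 5`, any cuts) to these sorted normal
forms (slot relabelling by `𝔖₅` via `…LaplaceRelabel.lean`, re-indexing, orientation), and the 10 exceptional types,
for which no certificate for `certified_no_decomposition2` exists (exhaustive search; evidence of seat
val-width-24813-w1 on stmt-24813) — they need a different argument and remain OPEN.  HONEST FRAMING: an exact partial
result toward the frontier rung `LaplaceOptimalFive` (stmt-24813), which stays OPEN; nothing here bears on `VP ≠ VNP`.
-/

set_option autoImplicit false

-- the mandated summit-side namespace repeats a component by design (single-problem summit)
set_option linter.dupNamespace false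

namespace Summit.ValiantsHypothesis.ValiantsHypothesis.Theorems.RigidityForcesSymmetryRankRigidMinimalRepr

namespace LaplaceFiveSlices

open Finset

/-- **From a table certificate to the refutation.**  Three slices at the slots `i`, three pair terms on the cuts
`(![p0,p1,p2] t, ![q0,q1,q2] t)`; a certificate `c = ((o, oi), (side, lp, e1, e2), (hb, bp, dk, dt))` passing the eight
clauses of the certificate tables (`…LaplaceFiveThreeSlicesCerts{A,B,C}.lean`) yields the hypotheses of
`certified_no_decomposition2` with `ord = ⟨o, oi⟩`, the basis marking `{bp}` (if `hb = 1`), and the single designation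
(`dk = 0`: slice `dt`; `dk = 1`: pair `dt`) at `bp`; hence the decomposition identity is impossible. -/
theorem three_slices_of_clauses (i : Fin 3 → Fin 5) (p0 q0 p1 q1 p2 q2 : Fin 5)
    (hne : ∀ t : Fin 3, (![p0, p1, p2] : Fin 3 → Fin 5) t ≠ (![q0, q1, q2] : Fin 3 → Fin 5) t)
    (α : Fin 3 → Fin 5 → ℂ) (W : Fin 3 → (Fin 5 → Fin 5) → ℂ)
    (hW : ∀ k, ∀ v v' : Fin 5 → Fin 5, (∀ j, j ≠ i k → v j = v' j) → W k v = W k v')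
    (u w : Fin 3 → (Fin 5 → Fin 5) → ℂ)
    (hu : ∀ t, ∀ v v' : Fin 5 → Fin 5,
      v ((![p0, p1, p2] : Fin 3 → Fin 5) t) = v' ((![p0, p1, p2] : Fin 3 → Fin 5) t) →
        v ((![q0, q1, q2] : Fin 3 → Fin 5) t) = v' ((![q0, q1, q2] : Fin 3 → Fin 5) t) → u t v = u t v')
    (hw : ∀ t, ∀ v v' : Fin 5 → Fin 5, (∀ j, j ≠ (![p0, p1, p2] : Fin 3 → Fin 5) t →
      j ≠ (![q0, q1, q2] : Fin 3 → Fin 5) t → v j = v' j) → w t v = w t v')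
    (c : ((Fin 5 → Fin 5) × (Fin 5 → Fin 5)) ×
      ((Fin 3 → Fin 2) × (Fin 3 → Fin 5) × (Fin 3 → Fin 5) × (Fin 3 → Fin 5)) × (Fin 2 × Fin 5 × Fin 2 × Fin 3))
    (hc : (decide (∀ t : Fin 3, c.2.1.1 t = 0 →
          (c.2.1.2.1 t = ![p0, p1, p2] t ∧ c.2.1.2.2.1 t = ![q0, q1, q2] t ∨
            c.2.1.2.1 t = ![q0, q1, q2] t ∧ c.2.1.2.2.1 t = ![p0, p1, p2] t) ∧
          c.1.2 (c.2.1.2.2.1 t) < c.1.2 (c.2.1.2.1 t))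
      && decide (∀ t : Fin 3, c.2.1.1 t = 1 →
          c.2.1.2.1 t ≠ ![p0, p1, p2] t ∧ c.2.1.2.1 t ≠ ![q0, q1, q2] t ∧
          c.2.1.2.2.1 t ≠ ![p0, p1, p2] t ∧ c.2.1.2.2.1 t ≠ ![q0, q1, q2] t ∧
          c.2.1.2.2.2 t ≠ ![p0, p1, p2] t ∧ c.2.1.2.2.2 t ≠ ![q0, q1, q2] t ∧
          c.2.1.2.2.1 t ≠ c.2.1.2.2.2 t ∧ c.2.1.2.2.1 t ≠ c.2.1.2.1 t ∧ c.2.1.2.2.2 t ≠ c.2.1.2.1 t ∧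
          c.1.2 (c.2.1.2.2.1 t) < c.1.2 (c.2.1.2.1 t) ∧ c.1.2 (c.2.1.2.2.2 t) < c.1.2 (c.2.1.2.1 t))
      && decide (∀ x : Fin 5, c.1.2 (c.1.1 x) = x)
      && decide (∀ x : Fin 5, c.1.1 (c.1.2 x) = x)
      && decide (c.2.2.1 = 1 → c.2.2.2.2.1 = 0 → c.2.2.2.1 < c.1.2 (i c.2.2.2.2.2))
      && decide (c.2.2.1 = 1 → c.2.2.2.2.1 = 1 →
          c.2.2.2.1 < c.1.2 (c.2.1.2.1 c.2.2.2.2.2) ∧ c.1.2 (c.2.1.2.2.1 c.2.2.2.2.2) < c.2.2.2.1 ∧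
          (c.2.1.1 c.2.2.2.2.2 = 1 → c.1.2 (c.2.1.2.2.2 c.2.2.2.2.2) < c.2.2.2.1))
      && decide (c.2.2.1 = 1 →
          (∀ k : Fin 3, i k ≠ c.1.1 c.2.2.2.1) ∧
          (∀ t : Fin 3, c.2.1.2.1 t ≠ c.1.1 c.2.2.2.1))
      && decide (∀ j : Fin 5, (c.2.2.1 = 1 → j ≠ c.2.2.2.1) →
          (if i 0 = c.1.1 j then 1 else 0) +
            (if i 1 = c.1.1 j then 1 else 0) +
            (if i 2 = c.1.1 j then 1 else 0) +
            (if c.2.1.2.1 0 = c.1.1 j then 1 else 0) +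
            (if c.2.1.2.1 1 = c.1.1 j then 1 else 0) +
            (if c.2.1.2.1 2 = c.1.1 j then 1 else 0) +
            (j : ℕ) + 1 ≤
            5 + (if c.2.2.1 = 1 ∧ c.2.2.2.1 < j ∧
              (if c.2.2.2.2.1 = 0 then i c.2.2.2.2.2
                else c.2.1.2.1 c.2.2.2.2.2) = c.1.1 j then 1 else 0))) = true) :
    ¬ ∀ v : Fin 5 → Fin 5, (if Function.Injective v then (1 : ℂ) else 0) =
        (∑ k, α k (v (i k)) * W k v) + ∑ t, u t v * w t v := by
  obtain ⟨⟨o, oi⟩, ⟨sd, lp, e1, e2⟩, ⟨hb, bp, dk, dt⟩⟩ := c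
  simp only [Bool.and_eq_true, decide_eq_true_eq] at hc
  obtain ⟨⟨⟨⟨⟨⟨⟨h1, h2⟩, h3⟩, h4⟩, h5⟩, h6⟩, h7⟩, h8⟩ := hc
  -- small facts about `Fin 2`
  have fin2 : ∀ x : Fin 2, x ≠ 1 → x = 0 := by decide
  -- the slot order as a permutation
  let ord : Equiv.Perm (Fin 5) := ⟨o, oi, h3, h4⟩
  have hord : ∀ x, ord x = o x := fun x => rfl
  have hsymm : ∀ x, ord.symm x = oi x := fun x => rfl
  -- the certificate data for `certified_no_decomposition2`
  let isB : Fin 5 → Bool := fun j => decide (hb = 1 ∧ j = bp)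
  let side : Fin 3 → Bool := fun t => decide (sd t = 1)
  let desS : Fin 5 → Option (Fin 3) := fun r => if hb = 1 ∧ r = bp ∧ dk = 0 then some dt else none
  let desP : Fin 5 → Option (Fin 3) := fun r => if hb = 1 ∧ r = bp ∧ dk = 1 then some dt else none
  have hdesS_iff : ∀ r k, desS r = some k ↔ (hb = 1 ∧ r = bp ∧ dk = 0) ∧ k = dt := by
    intro r k
    simp only [desS]
    split_ifs with h
    · simp [h, eq_comm]
    · simp [h]
  have hdesP_iff : ∀ r t, desP r = some t ↔ (hb = 1 ∧ r = bp ∧ dk = 1) ∧ t = dt := by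
    intro r t
    simp only [desP]
    split_ifs with h
    · simp [h, eq_comm]
    · simp [h]
  refine certified_no_decomposition2 i α W hW (![p0, p1, p2]) (![q0, q1, q2]) hne u w hu hw ord isB side lp e1 e2
    ?_ ?_ desS desP ?_ ?_ ?_ ?_ ?_ ?_ ?_ ?_
  · -- 2-slot sides
    intro t ht
    have hsd : sd t = 0 := fin2 _ (by simpa [side] using ht)
    obtain ⟨hor, hlt⟩ := h1 t hsd
    exact ⟨hor, by rw [hsymm, hsymm]; exact hlt⟩
  · -- 3-slot sides
    intro t ht
    have hsd : sd t = 1 := by simpa [side] using ht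
    obtain ⟨g1, g2, g3, g4, g5, g6, g7, g8, g9, g10, g11⟩ := h2 t hsd
    exact ⟨g1, g2, g3, g4, g5, g6, g7, g8, g9, by rw [hsymm, hsymm]; exact g10, by rw [hsymm, hsymm]; exact g11⟩
  · -- slice designation
    intro r k hk
    obtain ⟨⟨hb1, rfl, hk0⟩, rfl⟩ := (hdesS_iff r k).mp hk
    refine ⟨by simp [isB, hb1], ?_⟩
    rw [hsymm]; exact h5 hb1 hk0
  · -- pair designation
    intro r t ht
    obtain ⟨⟨hb1, rfl, hk1⟩, rfl⟩ := (hdesP_iff r t).mp ht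
    obtain ⟨a1, a2, a3⟩ := h6 hb1 hk1
    refine ⟨by simp [isB, hb1], by rw [hsymm]; exact a1, by rw [hsymm]; exact a2, fun hst => ?_⟩
    rw [hsymm]; exact a3 (by simpa [side] using hst)
  · -- one designation per position
    intro r
    by_cases hk : dk = 0
    · right
      simp only [desP]
      rw [if_neg]
      rintro ⟨-, -, h⟩; rw [hk] at h; exact absurd h (by decide)
    · left
      simp only [desS]
      rw [if_neg]
      rintro ⟨-, -, h⟩; exact hk h
  · intro r r' k k' hk hk' _
    obtain ⟨⟨-, rfl, -⟩, -⟩ := (hdesS_iff r k).mp hk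
    obtain ⟨⟨-, rfl, -⟩, -⟩ := (hdesS_iff r' k').mp hk'
    rfl
  · intro r r' k t hk ht
    obtain ⟨⟨-, -, h0⟩, -⟩ := (hdesS_iff r k).mp hk
    obtain ⟨⟨-, -, h1'⟩, -⟩ := (hdesP_iff r' t).mp ht
    rw [h0] at h1'; exact absurd h1' (by decide)
  · intro r r' t t' ht ht' _
    obtain ⟨⟨-, rfl, -⟩, -⟩ := (hdesP_iff r t).mp ht
    obtain ⟨⟨-, rfl, -⟩, -⟩ := (hdesP_iff r' t').mp ht'
    rfl
  · -- the general count
    intro j hj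
    have hjb : hb = 1 → j ≠ bp := by
      intro hb1 hjbp
      have : isB j = true := by simp [isB, hb1, hjbp]
      rw [this] at hj; exact Bool.noConfusion hj
    have hc8 := h8 j hjb
    rw [hord]
    rw [card_filter, card_filter, Fin.sum_univ_three, Fin.sum_univ_three]
    -- the credit: `cr ≤ #credited positions` for the goal's own filter
    refine le_trans ?_ (Nat.add_le_add_left
      (show (if hb = 1 ∧ bp < j ∧ (if dk = 0 then i dt else lp dt) = o j then 1 else 0) ≤ _ from ?_) 5)
    · omega
    · by_cases hcond : hb = 1 ∧ bp < j ∧ (if dk = 0 then i dt else lp dt) = o j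
      · rw [if_pos hcond]
        obtain ⟨hb1, hlt, hsl⟩ := hcond
        refine card_pos.mpr ⟨bp, ?_⟩
        simp only [mem_filter, mem_univ, true_and]
        refine ⟨hlt, ?_⟩
        by_cases hk : dk = 0
        · left
          rw [if_pos hk] at hsl
          exact ⟨dt, (hdesS_iff bp dt).mpr ⟨⟨hb1, rfl, hk⟩, rfl⟩, hsl⟩
        · right
          have hk1 : dk = 1 := by by_contra h; exact hk (fin2 dk h)
          rw [if_neg hk] at hsl
          exact ⟨dt, (hdesP_iff bp dt).mpr ⟨⟨hb1, rfl, hk1⟩, rfl⟩, hsl⟩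
      · rw [if_neg hcond]; exact Nat.zero_le _
  · -- the basis count
    intro j hj
    have hj' : hb = 1 ∧ j = bp := by simpa [isB] using hj
    obtain ⟨hb1, rfl⟩ := hj'
    obtain ⟨hs, hp⟩ := h7 hb1
    have e1' : (univ.filter (fun k => i k = ord j)).card = 0 := by
      rw [Finset.card_eq_zero, filter_eq_empty_iff]
      intro k _ hk; exact hs k (by rw [hord] at hk; exact hk)
    have e2' : (univ.filter (fun t => lp t = ord j)).card = 0 := by
      rw [Finset.card_eq_zero, filter_eq_empty_iff]
      intro t _ ht; exact hp t (by rw [hord] at ht; exact ht)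
    rw [e1', e2']
    exact Nat.zero_le _

/-- **Slot pattern `{x,x,x}`: every certified sorted configuration is refuted.**  Three slices on the slots `![0, 0, 0]`
(vectors `α_k`, cofactors `W_k` blind to the slice's slot), three pair terms on sorted cuts `(p t, q t)` outside the
14 exceptions of `three_slices_certs_A` (factors `u_t(v_p, v_q)`, `w_t` blind to `p, q`; zero terms allowed): the
`5 × 5` permutation pattern is not their sum. -/
theorem three_slices_sorted_A (p0 q0 p1 q1 p2 q2 : Fin 5) (h0 : p0 < q0) (h1 : p1 < q1) (h2 : p2 < q2)
    (hs1 : (p0 : ℕ) * 5 + q0 ≤ (p1 : ℕ) * 5 + q1) (hs2 : (p1 : ℕ) * 5 + q1 ≤ (p2 : ℕ) * 5 + q2)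
    (hexc : (p0, q0, p1, q1, p2, q2) ∉ ([
      (1, 2, 1, 2, 3, 4), (1, 2, 1, 3, 1, 4), (1, 2, 1, 3, 2, 3), (1, 2, 1, 4, 2, 4), (1, 2, 2, 3, 2, 4),
      (1, 2, 3, 4, 3, 4), (1, 3, 1, 3, 2, 4), (1, 3, 1, 4, 3, 4), (1, 3, 2, 3, 3, 4), (1, 3, 2, 4, 2, 4),
      (1, 4, 1, 4, 2, 3), (1, 4, 2, 3, 2, 3), (1, 4, 2, 4, 3, 4), (2, 3, 2, 4, 3, 4)] :
      List (Fin 5 × Fin 5 × Fin 5 × Fin 5 × Fin 5 × Fin 5)))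
    (α : Fin 3 → Fin 5 → ℂ) (W : Fin 3 → (Fin 5 → Fin 5) → ℂ)
    (hW : ∀ k, ∀ v v' : Fin 5 → Fin 5, (∀ j, j ≠ (![0, 0, 0] : Fin 3 → Fin 5) k → v j = v' j) → W k v = W k v')
    (u w : Fin 3 → (Fin 5 → Fin 5) → ℂ)
    (hu : ∀ t, ∀ v v' : Fin 5 → Fin 5,
      v ((![p0, p1, p2] : Fin 3 → Fin 5) t) = v' ((![p0, p1, p2] : Fin 3 → Fin 5) t) →
        v ((![q0, q1, q2] : Fin 3 → Fin 5) t) = v' ((![q0, q1, q2] : Fin 3 → Fin 5) t) → u t v = u t v')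
    (hw : ∀ t, ∀ v v' : Fin 5 → Fin 5, (∀ j, j ≠ (![p0, p1, p2] : Fin 3 → Fin 5) t →
      j ≠ (![q0, q1, q2] : Fin 3 → Fin 5) t → v j = v' j) → w t v = w t v') :
    ¬ ∀ v : Fin 5 → Fin 5, (if Function.Injective v then (1 : ℂ) else 0) =
        (∑ k, α k (v ((![0, 0, 0] : Fin 3 → Fin 5) k)) * W k v) + ∑ t, u t v * w t v := by
  have hne : ∀ t : Fin 3, (![p0, p1, p2] : Fin 3 → Fin 5) t ≠ (![q0, q1, q2] : Fin 3 → Fin 5) t := by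
    intro t
    fin_cases t
    · exact ne_of_lt h0
    · exact ne_of_lt h1
    · exact ne_of_lt h2
  obtain ⟨c, -, hc⟩ := List.any_eq_true.mp (three_slices_certs_A p0 q0 h0 p1 q1 h1 hs1 p2 q2 h2 hs2 hexc)
  exact three_slices_of_clauses ![0, 0, 0] p0 q0 p1 q1 p2 q2 hne α W hW u w hu hw c hc

/-- **Slot pattern `{x,x,y}`: every certified sorted configuration is refuted.**  Three slices on the slots `![0, 0, 1]`
(vectors `α_k`, cofactors `W_k` blind to the slice's slot), three pair terms on sorted cuts `(p t, q t)` outside the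
6 exceptions of `three_slices_certs_B` (factors `u_t(v_p, v_q)`, `w_t` blind to `p, q`; zero terms allowed): the
`5 × 5` permutation pattern is not their sum. -/
theorem three_slices_sorted_B (p0 q0 p1 q1 p2 q2 : Fin 5) (h0 : p0 < q0) (h1 : p1 < q1) (h2 : p2 < q2)
    (hs1 : (p0 : ℕ) * 5 + q0 ≤ (p1 : ℕ) * 5 + q1) (hs2 : (p1 : ℕ) * 5 + q1 ≤ (p2 : ℕ) * 5 + q2)
    (hexc : (p0, q0, p1, q1, p2, q2) ∉ ([
      (0, 1, 0, 1, 0, 1), (1, 2, 1, 3, 1, 4), (1, 2, 2, 3, 2, 4), (1, 3, 2, 3, 3, 4), (1, 4, 2, 4, 3, 4),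
      (2, 3, 2, 4, 3, 4)] :
      List (Fin 5 × Fin 5 × Fin 5 × Fin 5 × Fin 5 × Fin 5)))
    (α : Fin 3 → Fin 5 → ℂ) (W : Fin 3 → (Fin 5 → Fin 5) → ℂ)
    (hW : ∀ k, ∀ v v' : Fin 5 → Fin 5, (∀ j, j ≠ (![0, 0, 1] : Fin 3 → Fin 5) k → v j = v' j) → W k v = W k v')
    (u w : Fin 3 → (Fin 5 → Fin 5) → ℂ)
    (hu : ∀ t, ∀ v v' : Fin 5 → Fin 5,
      v ((![p0, p1, p2] : Fin 3 → Fin 5) t) = v' ((![p0, p1, p2] : Fin 3 → Fin 5) t) →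
        v ((![q0, q1, q2] : Fin 3 → Fin 5) t) = v' ((![q0, q1, q2] : Fin 3 → Fin 5) t) → u t v = u t v')
    (hw : ∀ t, ∀ v v' : Fin 5 → Fin 5, (∀ j, j ≠ (![p0, p1, p2] : Fin 3 → Fin 5) t →
      j ≠ (![q0, q1, q2] : Fin 3 → Fin 5) t → v j = v' j) → w t v = w t v') :
    ¬ ∀ v : Fin 5 → Fin 5, (if Function.Injective v then (1 : ℂ) else 0) =
        (∑ k, α k (v ((![0, 0, 1] : Fin 3 → Fin 5) k)) * W k v) + ∑ t, u t v * w t v := by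
  have hne : ∀ t : Fin 3, (![p0, p1, p2] : Fin 3 → Fin 5) t ≠ (![q0, q1, q2] : Fin 3 → Fin 5) t := by
    intro t
    fin_cases t
    · exact ne_of_lt h0
    · exact ne_of_lt h1
    · exact ne_of_lt h2
  obtain ⟨c, -, hc⟩ := List.any_eq_true.mp (three_slices_certs_B p0 q0 h0 p1 q1 h1 hs1 p2 q2 h2 hs2 hexc)
  exact three_slices_of_clauses ![0, 0, 1] p0 q0 p1 q1 p2 q2 hne α W hW u w hu hw c hc

/-- **Slot pattern `{x,y,z}`: every certified sorted configuration is refuted.**  Three slices on the slots `![0, 1, 2]`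
(vectors `α_k`, cofactors `W_k` blind to the slice's slot), three pair terms on sorted cuts `(p t, q t)` outside the
7 exceptions of `three_slices_certs_C` (factors `u_t(v_p, v_q)`, `w_t` blind to `p, q`; zero terms allowed): the
`5 × 5` permutation pattern is not their sum. -/
theorem three_slices_sorted_C (p0 q0 p1 q1 p2 q2 : Fin 5) (h0 : p0 < q0) (h1 : p1 < q1) (h2 : p2 < q2)
    (hs1 : (p0 : ℕ) * 5 + q0 ≤ (p1 : ℕ) * 5 + q1) (hs2 : (p1 : ℕ) * 5 + q1 ≤ (p2 : ℕ) * 5 + q2)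
    (hexc : (p0, q0, p1, q1, p2, q2) ∉ ([
      (0, 1, 0, 1, 0, 1), (0, 1, 0, 2, 1, 2), (0, 1, 0, 2, 3, 4), (0, 1, 1, 2, 3, 4), (0, 2, 0, 2, 0, 2),
      (0, 2, 1, 2, 3, 4), (1, 2, 1, 2, 1, 2)] :
      List (Fin 5 × Fin 5 × Fin 5 × Fin 5 × Fin 5 × Fin 5)))
    (α : Fin 3 → Fin 5 → ℂ) (W : Fin 3 → (Fin 5 → Fin 5) → ℂ)
    (hW : ∀ k, ∀ v v' : Fin 5 → Fin 5, (∀ j, j ≠ (![0, 1, 2] : Fin 3 → Fin 5) k → v j = v' j) → W k v = W k v')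
    (u w : Fin 3 → (Fin 5 → Fin 5) → ℂ)
    (hu : ∀ t, ∀ v v' : Fin 5 → Fin 5,
      v ((![p0, p1, p2] : Fin 3 → Fin 5) t) = v' ((![p0, p1, p2] : Fin 3 → Fin 5) t) →
        v ((![q0, q1, q2] : Fin 3 → Fin 5) t) = v' ((![q0, q1, q2] : Fin 3 → Fin 5) t) → u t v = u t v')
    (hw : ∀ t, ∀ v v' : Fin 5 → Fin 5, (∀ j, j ≠ (![p0, p1, p2] : Fin 3 → Fin 5) t →
      j ≠ (![q0, q1, q2] : Fin 3 → Fin 5) t → v j = v' j) → w t v = w t v') :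
    ¬ ∀ v : Fin 5 → Fin 5, (if Function.Injective v then (1 : ℂ) else 0) =
        (∑ k, α k (v ((![0, 1, 2] : Fin 3 → Fin 5) k)) * W k v) + ∑ t, u t v * w t v := by
  have hne : ∀ t : Fin 3, (![p0, p1, p2] : Fin 3 → Fin 5) t ≠ (![q0, q1, q2] : Fin 3 → Fin 5) t := by
    intro t
    fin_cases t
    · exact ne_of_lt h0
    · exact ne_of_lt h1
    · exact ne_of_lt h2
  obtain ⟨c, -, hc⟩ := List.any_eq_true.mp (three_slices_certs_C p0 q0 h0 p1 q1 h1 hs1 p2 q2 h2 hs2 hexc)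
  exact three_slices_of_clauses ![0, 1, 2] p0 q0 p1 q1 p2 q2 hne α W hW u w hu hw c hc

end LaplaceFiveSlices

end Summit.ValiantsHypothesis.ValiantsHypothesis.Theorems.RigidityForcesSymmetryRankRigidMinimalRepr
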